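import Mathlib
/-! # Stub `stub_exposure` — crux `TwoProducts` (stmt-ValiantsHypothesis-5906), line `corner-log-linearization`
   Every extreme point `p` of the convex hull of the real embedding `emb e = (e₀, e₁)` of a finite
   set `S ⊆ ℕ²` is `emb e` for some `e ∈ S` which is the UNIQUE minimiser over `S` of an INTEGER
   linear form `w₀ x₀ + w₁ x₁`.  Proof: strict separation of `p` from `conv (emb S ∖ {p})`
   (geometric Hahn–Banach against the compact hull of the other points) gives a real form `ξ`
   strictly exposing `p` as a minimum; on the finite set `S` the gaps are `≥ δ > 0` and the
   coordinate differences are `≤ M`, so for `K δ > M` the coordinatewise integer rounding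
   `w i = ⌊K ξ i⌋` still strictly exposes `e`. [folklore] -/
set_option linter.dupNamespace false -- single-conjunct summit: `ValiantsHypothesis.ValiantsHypothesis`
namespace Summit.ValiantsHypothesis.ValiantsHypothesis.Theorems.TwoProducts.Exposure
open scoped BigOperators

/-- Strict exposure of an extreme point of the convex hull of a finite planar set by a real linear
form written in coordinates: `p` is the unique minimiser of `ξ₀ x₀ + ξ₁ x₁` over the set.
(Hahn–Banach against the compact convex hull of the other points.) [folklore] -/
theorem exists_real_form_of_mem_extremePoints (T : Set (Fin 2 → ℝ)) (hT : T.Finite)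
    (p : Fin 2 → ℝ) (hp : p ∈ Set.extremePoints ℝ (convexHull ℝ T)) :
    p ∈ T ∧ ∃ ξ : Fin 2 → ℝ, ∀ q ∈ T, q ≠ p → ξ 0 * p 0 + ξ 1 * p 1 < ξ 0 * q 0 + ξ 1 * q 1 := by
  -- adapted from Literature/Computability/AlgebraicComplexity/BirkhoffShadowProofs.lean
  -- (`extremePoints_subset_um4`) and Cruxes/DissociatedFixedK/FullProof-annihilator-product-functional §E0
  have hpT : p ∈ T := extremePoints_convexHull_subset hp
  have hnot : p ∉ convexHull ℝ (T \ {p}) := by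
    have h := ((convex_convexHull ℝ T).mem_extremePoints_iff_mem_sdiff_convexHull_sdiff).1 hp
    have hsub : T \ {p} ⊆ convexHull ℝ T \ {p} := fun x hx => ⟨subset_convexHull ℝ T hx.1, hx.2⟩
    exact fun h' => h.2 (convexHull_mono hsub h')
  obtain ⟨f, u, hfu, hf⟩ := geometric_hahn_banach_point_closed (convex_convexHull ℝ _)
    (Set.Finite.isCompact_convexHull (𝕜 := ℝ) (hT.subset fun x hx => hx.1)).isClosed hnot
  have hf2 : ∀ x : Fin 2 → ℝ, f x = f (Pi.single 0 1) * x 0 + f (Pi.single 1 1) * x 1 := by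
    intro x
    have hx : x = x 0 • (Pi.single 0 1 : Fin 2 → ℝ) + x 1 • (Pi.single 1 1 : Fin 2 → ℝ) := by
      ext i
      fin_cases i <;> simp
    conv_lhs => rw [hx]
    simp only [map_add, map_smul, smul_eq_mul]
    ring
  refine ⟨hpT, fun i => f (Pi.single i 1), fun q hq hne => ?_⟩
  have h := hfu.trans (hf q (subset_convexHull ℝ _ ⟨hq, hne⟩))
  rwa [hf2 p, hf2 q] at h

/-- The rounding estimate: if `w₀, w₁` are the integer parts of `K ξ₀, K ξ₁`, the real form has gap
`≥ δ` along `(a, b)`, `|a| + |b| ≤ M` and `M < K δ`, then the rounded form is still positive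
along `(a, b)`. [folklore] -/
theorem rounding_pos (K δ M ξ₀ ξ₁ w₀ w₁ a b : ℝ) (hK : 0 ≤ K) (hKδ : M < K * δ)
    (hgap : δ ≤ ξ₀ * a + ξ₁ * b) (hM : |a| + |b| ≤ M)
    (h₀ : w₀ ≤ K * ξ₀) (h₀' : K * ξ₀ < w₀ + 1) (h₁ : w₁ ≤ K * ξ₁) (h₁' : K * ξ₁ < w₁ + 1) :
    0 < w₀ * a + w₁ * b := by
  have hr₀ : (K * ξ₀ - w₀) * a ≤ |a| := by
    calc (K * ξ₀ - w₀) * a ≤ |(K * ξ₀ - w₀) * a| := le_abs_self _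
      _ = (K * ξ₀ - w₀) * |a| := by rw [abs_mul, abs_of_nonneg (by linarith)]
      _ ≤ 1 * |a| := mul_le_mul_of_nonneg_right (by linarith) (abs_nonneg _)
      _ = |a| := one_mul _
  have hr₁ : (K * ξ₁ - w₁) * b ≤ |b| := by
    calc (K * ξ₁ - w₁) * b ≤ |(K * ξ₁ - w₁) * b| := le_abs_self _
      _ = (K * ξ₁ - w₁) * |b| := by rw [abs_mul, abs_of_nonneg (by linarith)]
      _ ≤ 1 * |b| := mul_le_mul_of_nonneg_right (by linarith) (abs_nonneg _)
      _ = |b| := one_mul _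
  have hKg : K * δ ≤ K * (ξ₀ * a + ξ₁ * b) := mul_le_mul_of_nonneg_left hgap hK
  have key : w₀ * a + w₁ * b = K * (ξ₀ * a + ξ₁ * b) - ((K * ξ₀ - w₀) * a + (K * ξ₁ - w₁) * b) := by
    ring
  rw [key]
  linarith

/-- Rounding a strictly exposing REAL form on a finite set of lattice points to an INTEGER one:
if `e` is the unique minimiser over `S` of `ξ₀ x₀ + ξ₁ x₁`, it is also the unique minimiser of some
integer form `w₀ x₀ + w₁ x₁` (take `w i = ⌊K ξ i⌋` for `K` large). [folklore] -/
theorem exists_int_form_of_real_form (S : Finset (Fin 2 →₀ ℕ)) (e : Fin 2 →₀ ℕ) (ξ : Fin 2 → ℝ)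
    (hξ : ∀ e' ∈ S, e' ≠ e →
      ξ 0 * (e 0 : ℝ) + ξ 1 * (e 1 : ℝ) < ξ 0 * (e' 0 : ℝ) + ξ 1 * (e' 1 : ℝ)) :
    ∃ w : Fin 2 → ℤ, ∀ e' ∈ S, e' ≠ e →
      w 0 * (e 0 : ℤ) + w 1 * (e 1 : ℤ) < w 0 * (e' 0 : ℤ) + w 1 * (e' 1 : ℤ) := by
  classical
  -- the positive gaps on the finite set `S.erase e` are bounded below by some `δ > 0`
  obtain ⟨δ, hδ, hgap⟩ : ∃ δ : ℝ, 0 < δ ∧ ∀ e' ∈ S, e' ≠ e →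
      δ ≤ ξ 0 * ((e' 0 : ℝ) - e 0) + ξ 1 * ((e' 1 : ℝ) - e 1) := by
    by_cases hT : (S.erase e).Nonempty
    · obtain ⟨e₀, he₀, hmin⟩ := Finset.exists_min_image (S.erase e)
        (fun e' : Fin 2 →₀ ℕ => ξ 0 * ((e' 0 : ℝ) - e 0) + ξ 1 * ((e' 1 : ℝ) - e 1)) hT
      refine ⟨_, ?_, fun e' he' hne => hmin e' (Finset.mem_erase.2 ⟨hne, he'⟩)⟩
      have h := hξ e₀ (Finset.mem_of_mem_erase he₀) (Finset.ne_of_mem_erase he₀)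
      linarith
    · refine ⟨1, one_pos, fun e' he' hne => ?_⟩
      exact absurd ⟨e', Finset.mem_erase.2 ⟨hne, he'⟩⟩ hT
  -- a uniform bound `M` on the coordinate differences
  obtain ⟨M, hMb⟩ : ∃ M : ℝ, ∀ e' ∈ S, |((e' 0 : ℝ) - e 0)| + |((e' 1 : ℝ) - e 1)| ≤ M := by
    refine ⟨(S.sup (fun e' : Fin 2 →₀ ℕ => e' 0 + e' 1) : ℕ) + ((e 0 : ℝ) + e 1), fun e' he' => ?_⟩
    have h1 : e' 0 + e' 1 ≤ S.sup (fun e' : Fin 2 →₀ ℕ => e' 0 + e' 1) :=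
      Finset.le_sup (f := fun e' : Fin 2 →₀ ℕ => e' 0 + e' 1) he'
    have h1' : ((e' 0 : ℝ) + e' 1) ≤ (S.sup (fun e' : Fin 2 →₀ ℕ => e' 0 + e' 1) : ℕ) := by
      exact_mod_cast h1
    have h0 : (0 : ℝ) ≤ e 0 := Nat.cast_nonneg _
    have h0' : (0 : ℝ) ≤ e 1 := Nat.cast_nonneg _
    have h2 : (0 : ℝ) ≤ e' 0 := Nat.cast_nonneg _
    have h2' : (0 : ℝ) ≤ e' 1 := Nat.cast_nonneg _
    have ha : |((e' 0 : ℝ) - e 0)| ≤ e' 0 + e 0 := abs_sub_le_iff.2 ⟨by linarith, by linarith⟩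
    have hb : |((e' 1 : ℝ) - e 1)| ≤ e' 1 + e 1 := abs_sub_le_iff.2 ⟨by linarith, by linarith⟩
    linarith
  -- choose the scale `K` with `M < K δ` and round
  obtain ⟨K, hK⟩ := exists_nat_gt (M / δ)
  have hKδ : M < (K : ℝ) * δ := (div_lt_iff₀ hδ).1 hK
  obtain ⟨w, hw₀, hw₀', hw₁, hw₁'⟩ : ∃ w : Fin 2 → ℤ, ((w 0 : ℤ) : ℝ) ≤ (K : ℝ) * ξ 0 ∧
      (K : ℝ) * ξ 0 < (w 0 : ℝ) + 1 ∧ ((w 1 : ℤ) : ℝ) ≤ (K : ℝ) * ξ 1 ∧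
      (K : ℝ) * ξ 1 < (w 1 : ℝ) + 1 :=
    ⟨fun i => ⌊(K : ℝ) * ξ i⌋, Int.floor_le _, Int.lt_floor_add_one _, Int.floor_le _,
      Int.lt_floor_add_one _⟩
  refine ⟨w, fun e' he' hne => ?_⟩
  have hpos : (0 : ℝ) < (w 0 : ℝ) * ((e' 0 : ℝ) - e 0) + (w 1 : ℝ) * ((e' 1 : ℝ) - e 1) :=
    rounding_pos K δ M (ξ 0) (ξ 1) (w 0) (w 1) _ _ (Nat.cast_nonneg K) hKδ (hgap e' he' hne)
      (hMb e' he') hw₀ hw₀' hw₁ hw₁'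
  have key : ((w 0 : ℤ) : ℝ) * ((e 0 : ℕ) : ℝ) + ((w 1 : ℤ) : ℝ) * ((e 1 : ℕ) : ℝ) <
      ((w 0 : ℤ) : ℝ) * ((e' 0 : ℕ) : ℝ) + ((w 1 : ℤ) : ℝ) * ((e' 1 : ℕ) : ℝ) := by
    linarith
  exact_mod_cast key

/-- **Stub `stub_exposure`.**  Every extreme point of the convex hull of the real embedding of a
finite set `S ⊆ ℕ²` is `emb e` for some `e ∈ S` which is the unique minimiser over `S` of an
integer linear form `w₀ x₀ + w₁ x₁`. [folklore] -/
theorem stub_exposure : ∀ (S : Finset (Fin 2 →₀ ℕ)) (p : Fin 2 → ℝ),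
    p ∈ Set.extremePoints ℝ (convexHull ℝ
      ((fun e : Fin 2 →₀ ℕ => fun i : Fin 2 => ((e i : ℕ) : ℝ)) '' (S : Set (Fin 2 →₀ ℕ)))) →
    ∃ e : Fin 2 →₀ ℕ, (fun i : Fin 2 => ((e i : ℕ) : ℝ)) = p ∧ ∃ w : Fin 2 → ℤ,
      e ∈ S ∧ ∀ e' ∈ S, e' ≠ e →
        w 0 * (e 0 : ℤ) + w 1 * (e 1 : ℤ) < w 0 * (e' 0 : ℤ) + w 1 * (e' 1 : ℤ) := by
  intro S p hp
  have hfin : ((fun e : Fin 2 →₀ ℕ => fun i : Fin 2 => ((e i : ℕ) : ℝ)) ''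
      (S : Set (Fin 2 →₀ ℕ))).Finite := S.finite_toSet.image _
  obtain ⟨hpT, ξ, hξ⟩ := exists_real_form_of_mem_extremePoints _ hfin p hp
  obtain ⟨e, he, rfl⟩ := hpT
  have hξ' : ∀ e' ∈ S, e' ≠ e →
      ξ 0 * (e 0 : ℝ) + ξ 1 * (e 1 : ℝ) < ξ 0 * (e' 0 : ℝ) + ξ 1 * (e' 1 : ℝ) := by
    intro e' he' hne
    have hne' : (fun i : Fin 2 => ((e' i : ℕ) : ℝ)) ≠ (fun i : Fin 2 => ((e i : ℕ) : ℝ)) := by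
      intro h
      apply hne
      ext i
      exact_mod_cast congr_fun h i
    exact hξ _ ⟨e', Finset.mem_coe.2 he', rfl⟩ hne'
  obtain ⟨w, hw⟩ := exists_int_form_of_real_form S e ξ hξ'
  exact ⟨e, rfl, w, Finset.mem_coe.1 he, hw⟩

end Summit.ValiantsHypothesis.ValiantsHypothesis.Theorems.TwoProducts.Exposure
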